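import Summits.QuantumFields.BalabanUV.Beta.GAN24.E3SlotDivergence

/-!
# `BalabanUV.Beta.GAN24.LayerCommutatorSupport` — binder row G-an2-4 / (CONV-C), CT-W route «WC-TL» → «QR-LL» (the OWNER gan24-p1
# g25's `gen25/QR-DESIGN-v0.md` 66f87a030fd031ac §3 (LAY), support lemma (B)):
# **THE COMMUTATOR OF A LOCALISED STENCIL WITH THE BLOCK GAUGE GENERATOR LIVES NEAR THE BOUNDARY LAYER OF THE BLOCK**

NOT IN PRINT; OUR BOOKKEEPING (G-an2-4 formalisation swarm → CRUX TEAM (2), leaf prover `b2b-balaban-gan24-formalise-leaf-03`, gen 58; INTENT 5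
«(LAY) SUPPORT (B)», journal `CLAIMS.log`; names PROVISIONAL — the OWNER ∕ leaf-01 ((LT) consumer) may rename ∕ re-cut).  [folklore] lattice
geometry on `ℤ^{d+1}` + one split exponential over an1's `DiagonalContact.comp_diagK_right ∕ _left` and the tree's `LocStencil` ∕ `BiLoc` ∕ `legInd`
BY NAME; generic `d`; 0 `def`, 0 cited facts, 0 `def … : Prop`, 0 sorry.  HONEST FRAMING (cell contract, verbatim): «discharging `BetaPertH` makes
Bałaban's UV stability UNCONDITIONAL — a real constructive-QFT result; it is NOT the continuum limit and NOT the Clay problem.»  HONEST DEPENDENCY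
(verbatim): «continuum YM on T⁴ ⇐ BetaPertH ∧ nine spine estimates (0/9 proved); BetaPertH ⇐ (D1) ∧ (D4) ∧ CAP+tail; G-an2-4 gates asym, D1 and NE2/3/4.»

## What
The Ward-locus table law `WardLocusRecursiveStep.tableLaw_T2RecAt_succ` carries, per label, the commutator `S κ′u′ ∘ diagK g − diagK g ∘ S κ′u′` of the
pure-S stencil with the DIAGONAL gauge generator `g = ξ • Σ σ` of leg indicators; summed over the labels of a finite fine region `B` (QR-DESIGN §2 (P1),
p2 g37's `WardResidualLabelSums`) the symbol is `ξ • Σ_{u∈B} legInd ρ u`, i.e. `[legSite ρ z b ∈ B]·ξ` (`smul_sum_legInd_apply`).  THIS FILE: that summed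
commutator is bi-localised at `u′` with a constant that DECAYS IN THE DISTANCE FROM `u′` TO THE DISCRETE BOUNDARY LAYER OF `B`.
* §1 GEOMETRY (no analysis): the boundary layer of a finite `B ⊂ ℤ^{d+1}` is the union over directions `μ` of the inner face `B ∖ (B − e_μ)` and the
  outer face `(B − e_μ) ∖ B` — EXACTLY the index sets of `BlockDivergenceFlux.finsetSum_divV_eq_layers` (`mem_faces_iff`); **`exists_face_between`**
  (BOUNDARY CROSSING): `r₁ ∈ B`, `r₂ ∉ B` ⇒ some layer site `w` has `|w − r₁|₁ + |w − r₂|₁ ≤ |r₁ − r₂|₁` (induction along a monotone lattice path: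
  `l1_sub_toward`); hence **`le_l1_add_l1_of_straddle`**: every lower bound `R` of `|w − u′|₁` over the layer satisfies `R ≤ |r₁ − u′|₁ + |r₂ − u′|₁`.
  NO `dist(u′, ∂B)` is defined: `R` is a WITNESS-LEVEL binder (`hR : ∀ μ w, w ∈ layer_μ → R ≤ |w − u′|₁`), as leaf-01 g63's LT-STATEMENT-v0 §3 asks.
* §2 THE INTERFACE FORM (RULING R-gan24p1-g25-2 (2), primary statement for (LT)) **`comm_diagK_legInd_entry`**: the commutator KEPT as a
  commutator, `[S κ′u′, diagK(ξ•Σ_{u∈B} legInd ρ u)] x z a b = ξ·S κ′u′ x z a b·(χ_B(legSite ρ z b) − χ_B(legSite ρ x a))` (zero unless the legs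
  straddle `B`, `comm_diagK_legInd_entry_eq_zero`); and its COROLLARY the envelope **`biLoc_comm_diagK_legInd`**: `LocStencil S C δ`, `0 ≤ δ` ⇒ for every finite `B`, root offset `ρ`, weight `ξ`, slot `(κ′,u′)` and
  witness `R`: `BiLoc (S κ′u′ ∘ diagK(ξ•Σ_{u∈B} legInd ρ u) − diagK(…) ∘ S κ′u′) u′ u′ (|ξ|·C·e^{δ|ρ|₁}·e^{−(δ∕2)R}) (δ∕2)` — an entry `S x z a b·(g z b − g x a)`
  (`comm_diagK_entry`) vanishes unless the legs `legSite ρ x a`, `legSite ρ z b` STRADDLE `B`; then §1 puts a layer site between them, the legs sit within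
  `|ρ|₁` of `x`, `z` (`l1_legSite_sub_le`), so `R ≤ |x−u′|₁ + |z−u′|₁ + 2|ρ|₁` and HALF the stencil's decay pays `e^{−(δ∕2)R}`; `conjV` spelling
  `biLoc_conjV_diagK_legInd`; the geometry-free case `R = 0` `biLoc_comm_diagK_legInd_zero`.
= QR-DESIGN-v0 §3 (LAY) «`LocStencil S C δ` ⇒ `[S κ′u′, diagK(½•1_B-legs)]` is `BiLoc` at `u′` with constant `C·e^{−δ·dist(u′,∂B)∕2}` at rate `δ∕2`», with
`dist` in witness form and the root offset's `e^{δ|ρ|₁}` made explicit (`ρ = toSite r`, `|ρ|₁ ≤ d+1` on the comb).  The `[G, X_B]` letter (`Decays G`) is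
the special case of a constant stencil family; the `T(∇1_B, ·)` letter is the sister file `LayerFluxSupport`.
DISCHARGES NO ROW: (LAY)'s one-step letter bounds, (LT), (REP)'s END and (Q-R) are NOT here; 0 estimate of Bałaban's; NOTHING of «T2Shape» ∕ «T2Drift» ∕
(hW, hWall) ∕ (C) discharged; NEVER «G-an2-4 closed» as (CONV-C); NOT D1, NOT BetaPertH, NOT continuum, NOT Clay.
-/

namespace Summit.QuantumFields.BalabanUV.Beta.GAN24.LayerCommutatorSupport

open Finset
open scoped BigOperators
open Literature.MathematicalPhysics.QuantumFieldTheory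
open Literature.MathematicalPhysics.QuantumFieldTheory.Balaban1983to89
open Literature.MathematicalPhysics.QuantumFieldTheory.Balaban1983to89.Beta
open Literature.MathematicalPhysics.QuantumFieldTheory.Balaban1983to89.B12Sec2to5 (l1 l1_nonneg)
open B6BondElimination (unitVec unitVec_apply)
open ExpKernelCalculus (MKer Site Decays BiLoc comp l1_sub_triangle l1_sub_symm)
open Summit.QuantumFields.BalabanUV.Beta.ChartConjugation (conjV)
open OneStepResolventKernel (Fib LocStencil)
open KernelWard (divV divW)
open Summit.QuantumFields.BalabanUV.Beta.BorderedHessian (diagK diagK_apply comp_diagK_right comp_diagK_left)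
open Summit.QuantumFields.BalabanUV.Beta.AveragingWardRootedStencils (legSite legInd legSite_inl legSite_inr)

variable {d : ℕ}

/-! ## §1 The discrete boundary layer and the boundary crossing -/

/-- The discrete boundary layer of a finite region `B ⊂ ℤ^{d+1}`: the union over the directions `μ` of the INNER face
`B ∖ (B − e_μ) = {p ∈ B : p + e_μ ∉ B}` and the OUTER face `(B − e_μ) ∖ B = {p ∉ B : p + e_μ ∈ B}` — exactly the two index
sets of `BlockDivergenceFlux.finsetSum_divV_eq_layers`. [folklore] -/
theorem mem_faces_iff (B : Finset (Site (d + 1))) (μ : Fin (d + 1)) (p : Site (d + 1)) :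
    (p ∈ B \ B.image (fun u => u - unitVec μ) ∨ p ∈ B.image (fun u => u - unitVec μ) \ B)
      ↔ ((p ∈ B ∧ p + unitVec μ ∉ B) ∨ (p ∉ B ∧ p + unitVec μ ∈ B)) := by
  have him : p ∈ B.image (fun u => u - unitVec μ) ↔ p + unitVec μ ∈ B := by
    constructor
    · rintro h
      obtain ⟨u, hu, rfl⟩ := Finset.mem_image.1 h
      simpa using hu
    · intro h
      exact Finset.mem_image.2 ⟨p + unitVec μ, h, by simp⟩
  simp only [Finset.mem_sdiff, him]
  tauto

/-- One unit step of `t ≠ 0` along a coordinate `μ` with `t_μ ≠ 0`, TOWARDS the origin, lowers `|t|₁` by exactly one. [folklore] -/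
theorem l1_sub_toward (t : Site (d + 1)) (μ : Fin (d + 1)) (hμ : t μ ≠ 0) :
    l1 (t - (if 0 < t μ then unitVec μ else -unitVec μ)) = l1 t - 1 := by
  have key : ∀ ν, |((t - (if 0 < t μ then unitVec μ else -unitVec μ)) ν : ℝ)| - |(t ν : ℝ)|
      = if ν = μ then -1 else 0 := by
    intro ν
    by_cases hν : ν = μ
    · subst hν
      simp only [if_true, Pi.sub_apply]
      by_cases ht : 0 < t ν
      · simp only [ht, if_true, unitVec_apply, Int.cast_sub, Int.cast_one]
        have h1 : (1 : ℝ) ≤ t ν := by exact_mod_cast ht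
        rw [abs_of_nonneg (by linarith), abs_of_pos (by linarith)]; ring
      · simp only [ht, if_false, Pi.neg_apply, unitVec_apply, if_true, sub_neg_eq_add, Int.cast_add,
          Int.cast_one]
        have h1 : (t ν : ℝ) ≤ -1 := by
          have : t ν ≤ -1 := by omega
          exact_mod_cast this
        rw [abs_of_nonpos (by linarith), abs_of_neg (by linarith)]; ring
    · simp only [hν, if_false, Pi.sub_apply]
      have h0 : ((if 0 < t μ then unitVec μ else -unitVec μ) : Site (d + 1)) ν = 0 := by
        split_ifs <;> simp [unitVec_apply, hν]
      simp [h0]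
  have hsum : l1 (t - (if 0 < t μ then unitVec μ else -unitVec μ)) - l1 t = -1 := by
    unfold l1
    rw [← Finset.sum_sub_distrib, Finset.sum_congr rfl fun ν _ => key ν, Finset.sum_ite_eq' Finset.univ μ,
      if_pos (Finset.mem_univ μ)]
  linarith

/-- `|−e|₁ = 1` for a signed unit vector. [folklore] -/
theorem l1_neg_signedUnit (t : Site (d + 1)) (μ : Fin (d + 1)) :
    l1 (-(if 0 < t μ then unitVec μ else -unitVec μ : Site (d + 1))) = 1 := by
  have h : ∀ e : Site (d + 1), l1 (-e) = l1 e := fun e => by unfold l1; simp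
  split_ifs
  · rw [h]; exact StepJetData.l1_unitVec μ
  · rw [neg_neg]; exact StepJetData.l1_unitVec μ

/-- Two distinct lattice points are at `ℓ¹`-distance at least one. [folklore] -/
theorem one_le_l1_sub_of_ne {r₁ r₂ : Site (d + 1)} (h : r₁ ≠ r₂) : 1 ≤ l1 (r₁ - r₂) := by
  obtain ⟨μ, hμ⟩ : ∃ μ, r₁ μ ≠ r₂ μ := by
    by_contra hc
    push Not at hc
    exact h (funext hc)
  have h1 : (1 : ℝ) ≤ |((r₁ - r₂) μ : ℝ)| := by
    have : (1 : ℤ) ≤ |(r₁ - r₂) μ| := by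
      have : (r₁ - r₂) μ ≠ 0 := by simpa [Pi.sub_apply, sub_eq_zero] using hμ
      exact Int.one_le_abs this
    have := (Int.cast_le (R := ℝ)).2 this
    simpa [Int.cast_abs] using this
  exact h1.trans (B12Sec2to5.abs_coord_le_l1 _ μ)

/-- **BOUNDARY CROSSING.** If `r₁ ∈ B` and `r₂ ∉ B` then some site `w` of the discrete boundary layer of `B` (an inner-face
or an outer-face site in some direction `μ`, `mem_faces_iff`) lies `ℓ¹`-BETWEEN them: `|w − r₁|₁ + |w − r₂|₁ ≤ |r₁ − r₂|₁`
(a monotone lattice path from `r₁` to `r₂` must exit `B`). [folklore] -/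
theorem exists_face_between (B : Finset (Site (d + 1))) {r₁ r₂ : Site (d + 1)} (h₁ : r₁ ∈ B) (h₂ : r₂ ∉ B) :
    ∃ μ w, (w ∈ B \ B.image (fun u => u - unitVec μ) ∨ w ∈ B.image (fun u => u - unitVec μ) \ B)
      ∧ l1 (w - r₁) + l1 (w - r₂) ≤ l1 (r₁ - r₂) := by
  suffices H : ∀ n : ℕ, ∀ r₁, r₁ ∈ B → l1 (r₁ - r₂) ≤ n →
      ∃ μ w, (w ∈ B \ B.image (fun u => u - unitVec μ) ∨ w ∈ B.image (fun u => u - unitVec μ) \ B)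
        ∧ l1 (w - r₁) + l1 (w - r₂) ≤ l1 (r₁ - r₂) by
    obtain ⟨n, hn⟩ := exists_nat_ge (l1 (r₁ - r₂))
    exact H n r₁ h₁ hn
  intro n
  induction n with
  | zero =>
    intro r₁ h₁ hle
    have hne : r₁ ≠ r₂ := fun h => h₂ (h ▸ h₁)
    have := one_le_l1_sub_of_ne hne
    simp only [Nat.cast_zero] at hle
    linarith
  | succ n ih =>
    intro r₁ h₁ hle
    have hne : r₁ ≠ r₂ := fun h => h₂ (h ▸ h₁)
    obtain ⟨μ, hμ⟩ : ∃ μ, (r₁ - r₂) μ ≠ 0 := by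
      by_contra hc
      push Not at hc
      exact hne (sub_eq_zero.1 (funext hc))
    set e : Site (d + 1) := if 0 < (r₁ - r₂) μ then unitVec μ else -unitVec μ with he
    have hl : l1 (r₁ - e - r₂) = l1 (r₁ - r₂) - 1 := by
      rw [show r₁ - e - r₂ = (r₁ - r₂) - e by abel]; exact l1_sub_toward (r₁ - r₂) μ hμ
    have hl' : l1 (r₁ - e - r₁) = 1 := by
      rw [show r₁ - e - r₁ = -e by abel]; exact l1_neg_signedUnit (r₁ - r₂) μ
    by_cases hB : r₁ - e ∈ B
    · -- still inside: induct
      have hle' : l1 (r₁ - e - r₂) ≤ n := by rw [hl]; push_cast at hle; linarith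
      obtain ⟨ν, w, hw, hdist⟩ := ih (r₁ - e) hB hle'
      refine ⟨ν, w, hw, ?_⟩
      have tri : l1 (w - r₁) ≤ l1 (w - (r₁ - e)) + l1 (r₁ - e - r₁) := l1_sub_triangle w (r₁ - e) r₁
      linarith
    · -- the step exits `B`: a face site is at hand
      by_cases ht : 0 < (r₁ - r₂) μ
      · -- `e = e_μ`, `r₁ − e_μ ∉ B`, `r₁ ∈ B`: OUTER face site `w := r₁ − e_μ` in direction `μ`
        have he' : e = unitVec μ := by rw [he, if_pos ht]
        refine ⟨μ, r₁ - e, Or.inr ?_, ?_⟩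
        · rw [Finset.mem_sdiff]
          exact ⟨Finset.mem_image.2 ⟨r₁, h₁, by rw [he']⟩, hB⟩
        · rw [hl', hl]; linarith
      · -- `e = −e_μ`, `r₁ + e_μ ∉ B`, `r₁ ∈ B`: INNER face site `w := r₁` in direction `μ`
        have he' : e = -unitVec μ := by rw [he, if_neg ht]
        refine ⟨μ, r₁, Or.inl ?_, ?_⟩
        · rw [Finset.mem_sdiff]
          refine ⟨h₁, fun him => hB ?_⟩
          obtain ⟨u, hu, hu'⟩ := Finset.mem_image.1 him
          have : u = r₁ - e := by rw [he']; rw [← hu']; abel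
          exact this ▸ hu
        · have : l1 (r₁ - r₁) = 0 := by unfold l1; simp
          rw [this, zero_add]

/-- From the boundary crossing and two triangle inequalities: if the legs `r₁ ∈ B`, `r₂ ∉ B` straddle the region, every
lower bound `R` on the `ℓ¹`-distance from `u′` to the boundary layer of `B` is at most `|r₁ − u′|₁ + |r₂ − u′|₁`. [folklore] -/
theorem le_l1_add_l1_of_straddle (B : Finset (Site (d + 1))) {r₁ r₂ : Site (d + 1)} (h₁ : r₁ ∈ B) (h₂ : r₂ ∉ B)
    (u' : Site (d + 1)) {R : ℝ}
    (hR : ∀ μ w, (w ∈ B \ B.image (fun u => u - unitVec μ) ∨ w ∈ B.image (fun u => u - unitVec μ) \ B) →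
      R ≤ l1 (w - u')) :
    R ≤ l1 (r₁ - u') + l1 (r₂ - u') := by
  obtain ⟨μ, w, hw, hdist⟩ := exists_face_between B h₁ h₂
  have hRw := hR μ w hw
  have t1 : l1 (w - u') ≤ l1 (w - r₁) + l1 (r₁ - u') := l1_sub_triangle w r₁ u'
  have t2 : l1 (w - u') ≤ l1 (w - r₂) + l1 (r₂ - u') := l1_sub_triangle w r₂ u'
  have t3 : l1 (r₁ - r₂) ≤ l1 (r₁ - u') + l1 (u' - r₂) := l1_sub_triangle r₁ u' r₂
  rw [l1_sub_symm u' r₂] at t3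
  linarith

/-! ## §2 The commutator with the block gauge generator -/

/-- A leg of the rooted stencil sits at its index site or at its root: `|legSite ρ z b − u′|₁ ≤ |z − u′|₁ + |ρ|₁`. [folklore] -/
theorem l1_legSite_sub_le (ρ z : Site (d + 1)) (b : Fib d) (u' : Site (d + 1)) :
    l1 (legSite ρ z b - u') ≤ l1 (z - u') + l1 ρ := by
  cases b with
  | inl α =>
    rw [legSite_inl]
    linarith [l1_nonneg ρ]
  | inr μ =>
    rw [legSite_inr]
    have h := l1_sub_triangle (z + ρ) z u'
    have h' : l1 (z + ρ - z) = l1 ρ := by rw [add_sub_cancel_left]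
    linarith

/-- The symbol of the summed leg indicators of a finite region: `(ξ • Σ_{u∈B} legInd ρ u) z b = [legSite ρ z b ∈ B]·ξ`. [folklore] -/
theorem smul_sum_legInd_apply (B : Finset (Site (d + 1))) (ρ : Site (d + 1)) (ξ : ℝ) (z : Site (d + 1)) (b : Fib d) :
    (ξ • ∑ u ∈ B, legInd ρ u) z b = if legSite ρ z b ∈ B then ξ else 0 := by
  simp only [Pi.smul_apply, Finset.sum_apply, AveragingWardRootedStencils.legInd, smul_eq_mul]
  rw [Finset.sum_ite_eq B (legSite ρ z b)]
  split_ifs <;> simp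

/-- Entries of the commutator with a diagonal kernel: `(S∘diagK g − diagK g∘S) x z a b = S x z a b·(g z b − g x a)`
(an1's `comp_diagK_right` ∕ `comp_diagK_left`). [folklore] -/
theorem comm_diagK_entry (g : Site (d + 1) → Fib d → ℝ) (K : MKer (d + 1) (Fib d)) (x z : Site (d + 1)) (a b : Fib d) :
    (comp K (diagK g) - comp (diagK g) K) x z a b = K x z a b * (g z b - g x a) := by
  simp only [Pi.sub_apply, comp_diagK_right, comp_diagK_left]
  ring

/-- **THE INTERFACE FORM (RULING R-gan24p1-g25-2 (2)): THE COMMUTATOR KEPT AS A COMMUTATOR.**  Entrywise,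
`[S κ′u′, diagK(ξ•Σ_{u∈B} legInd ρ u)] x z a b = ξ · S κ′u′ x z a b · (χ_B(legSite ρ z b) − χ_B(legSite ρ x a))` — a difference of the
region's indicator ACROSS THE KERNEL PAIR; nonzero only when the two legs straddle `B`.  This is the PRIMARY statement (LAY) hands to
(LT); the `BiLoc` envelope `biLoc_comm_diagK_legInd` below is its corollary. [folklore] -/
theorem comm_diagK_legInd_entry (S : Fin (d + 1) → Site (d + 1) → MKer (d + 1) (Fib d)) (B : Finset (Site (d + 1)))
    (ρ : Site (d + 1)) (ξ : ℝ) (κ' : Fin (d + 1)) (u' : Site (d + 1)) (x z : Site (d + 1)) (a b : Fib d) :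
    (comp (S κ' u') (diagK (ξ • ∑ u ∈ B, legInd ρ u)) - comp (diagK (ξ • ∑ u ∈ B, legInd ρ u)) (S κ' u')) x z a b
      = ξ * S κ' u' x z a b
          * ((if legSite ρ z b ∈ B then (1 : ℝ) else 0) - (if legSite ρ x a ∈ B then (1 : ℝ) else 0)) := by
  rw [comm_diagK_entry, smul_sum_legInd_apply, smul_sum_legInd_apply]
  split_ifs <;> ring

/-- The interface form vanishes unless the legs straddle the region. [folklore] -/
theorem comm_diagK_legInd_entry_eq_zero (S : Fin (d + 1) → Site (d + 1) → MKer (d + 1) (Fib d)) (B : Finset (Site (d + 1)))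
    (ρ : Site (d + 1)) (ξ : ℝ) (κ' : Fin (d + 1)) (u' : Site (d + 1)) (x z : Site (d + 1)) (a b : Fib d)
    (h : legSite ρ x a ∈ B ↔ legSite ρ z b ∈ B) :
    (comp (S κ' u') (diagK (ξ • ∑ u ∈ B, legInd ρ u)) - comp (diagK (ξ • ∑ u ∈ B, legInd ρ u)) (S κ' u')) x z a b = 0 := by
  rw [comm_diagK_legInd_entry]
  by_cases hz : legSite ρ z b ∈ B
  · rw [if_pos hz, if_pos (h.2 hz)]; ring
  · rw [if_neg hz, if_neg (fun hx => hz (h.1 hx))]; ring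

/-- **(LAY) SUPPORT LEMMA (B) — THE COMMUTATOR OF A LOCALISED STENCIL WITH THE BLOCK GAUGE GENERATOR LIVES NEAR `∂B`.**
For a `LocStencil S C δ` family (`δ ≥ 0`), a finite region `B ⊂ ℤ^{d+1}`, a root offset `ρ` and a weight `ξ`, the commutator
`[S κ′ u′, diagK (ξ • Σ_{u∈B} legInd ρ u)]` (the literal generator of `tableLaw_T2RecAt_succ` summed over the labels of `B`) is
bi-localised at `u′` at the HALVED rate `δ∕2` with constant `|ξ|·C·e^{δ|ρ|₁}·e^{−(δ∕2)·R}` for EVERY lower bound `R` on the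
`ℓ¹`-distance from `u′` to the discrete boundary layer of `B` (inner and outer faces in every direction — the index sets of
`BlockDivergenceFlux.finsetSum_divV_eq_layers`; no `dist` is defined: `R` is a witness-level binder).  Mechanism: an entry
`S x z a b·(g z b − g x a)` vanishes unless the two legs straddle `B`; then a boundary site lies `ℓ¹`-between the legs
(`exists_face_between`), so `R ≤ |x − u′|₁ + |z − u′|₁ + 2|ρ|₁`, and half of the stencil's decay pays for `e^{−(δ∕2)R}`.
QR-DESIGN-v0 §3 (LAY) «`LocStencil S C δ` ⇒ `[S κ′u′, diagK(½•1_B-legs)]` is `BiLoc` at `u′` with constant `C·e^{−δ·dist(u′,∂B)∕2}`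
at rate `δ∕2`». [folklore] -/
theorem biLoc_comm_diagK_legInd {S : Fin (d + 1) → Site (d + 1) → MKer (d + 1) (Fib d)} {C δ : ℝ}
    (hS : LocStencil S C δ) (hδ : 0 ≤ δ) (B : Finset (Site (d + 1))) (ρ : Site (d + 1)) (ξ : ℝ) (κ' : Fin (d + 1))
    (u' : Site (d + 1)) {R : ℝ}
    (hR : ∀ μ w, (w ∈ B \ B.image (fun u => u - unitVec μ) ∨ w ∈ B.image (fun u => u - unitVec μ) \ B) →
      R ≤ l1 (w - u')) :
    BiLoc (comp (S κ' u') (diagK (ξ • ∑ u ∈ B, legInd ρ u)) - comp (diagK (ξ • ∑ u ∈ B, legInd ρ u)) (S κ' u')) u' u'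
      (|ξ| * C * Real.exp (δ * l1 ρ) * Real.exp (-(δ / 2) * R)) (δ / 2) := by
  intro x z a b
  rw [comm_diagK_entry, smul_sum_legInd_apply, smul_sum_legInd_apply]
  have hC : 0 ≤ C := (hS κ' u').nonneg (Sum.inr 0)
  set A : ℝ := l1 (x - u') + l1 (z - u') with hA
  have hSx : |S κ' u' x z a b| ≤ C * Real.exp (-δ * A) := hS κ' u' x z a b
  have hRHS : 0 ≤ |ξ| * C * Real.exp (δ * l1 ρ) * Real.exp (-(δ / 2) * R) * Real.exp (-(δ / 2) * A) := by positivity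
  -- the straddling case, symmetric in the two legs
  have straddle : ∀ {r₁ r₂ : Site (d + 1)}, r₁ ∈ B → r₂ ∉ B →
      l1 (r₁ - u') + l1 (r₂ - u') ≤ A + 2 * l1 ρ →
      |S κ' u' x z a b| * |ξ| ≤ |ξ| * C * Real.exp (δ * l1 ρ) * Real.exp (-(δ / 2) * R) * Real.exp (-(δ / 2) * A) := by
    intro r₁ r₂ h₁ h₂ hsum
    have hRle : R ≤ A + 2 * l1 ρ := (le_l1_add_l1_of_straddle B h₁ h₂ u' hR).trans hsum
    have hexp : Real.exp (-δ * A) ≤ Real.exp (δ * l1 ρ) * Real.exp (-(δ / 2) * R) * Real.exp (-(δ / 2) * A) := by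
      rw [← Real.exp_add, ← Real.exp_add]
      apply Real.exp_le_exp.2
      nlinarith
    calc |S κ' u' x z a b| * |ξ| ≤ C * Real.exp (-δ * A) * |ξ| :=
          mul_le_mul_of_nonneg_right hSx (abs_nonneg _)
      _ ≤ C * (Real.exp (δ * l1 ρ) * Real.exp (-(δ / 2) * R) * Real.exp (-(δ / 2) * A)) * |ξ| :=
          mul_le_mul_of_nonneg_right (mul_le_mul_of_nonneg_left hexp hC) (abs_nonneg _)
      _ = _ := by ring
  have hb1 := l1_legSite_sub_le ρ x a u'
  have hb2 := l1_legSite_sub_le ρ z b u'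
  by_cases h1 : legSite ρ x a ∈ B <;> by_cases h2 : legSite ρ z b ∈ B
  · simp only [h1, h2, if_true, sub_self, mul_zero, abs_zero]; exact hRHS
  · rw [if_neg h2, if_pos h1, zero_sub, mul_neg, abs_neg, abs_mul]
    exact straddle h1 h2 (by linarith)
  · rw [if_pos h2, if_neg h1, sub_zero, abs_mul]
    exact straddle (r₁ := legSite ρ z b) (r₂ := legSite ρ x a) h2 h1 (by linarith)
  · simp only [h1, h2, if_false, sub_self, mul_zero, abs_zero]; exact hRHS

/-- The `conjV` spelling (`conjV M X = M∘X − X∘M`, the Ward kernel law's generator action): the same bound. [folklore] -/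
theorem biLoc_conjV_diagK_legInd {S : Fin (d + 1) → Site (d + 1) → MKer (d + 1) (Fib d)} {C δ : ℝ}
    (hS : LocStencil S C δ) (hδ : 0 ≤ δ) (B : Finset (Site (d + 1))) (ρ : Site (d + 1)) (ξ : ℝ) (κ' : Fin (d + 1))
    (u' : Site (d + 1)) {R : ℝ}
    (hR : ∀ μ w, (w ∈ B \ B.image (fun u => u - unitVec μ) ∨ w ∈ B.image (fun u => u - unitVec μ) \ B) →
      R ≤ l1 (w - u')) :
    BiLoc (conjV (S κ' u') (diagK (ξ • ∑ u ∈ B, legInd ρ u))) u' u'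
      (|ξ| * C * Real.exp (δ * l1 ρ) * Real.exp (-(δ / 2) * R)) (δ / 2) :=
  biLoc_comm_diagK_legInd hS hδ B ρ ξ κ' u' hR

/-- The TRIVIAL witness `R = 0` (no geometry): the commutator is at least as localised as the stencil at the halved rate,
uniformly in `B` — the bulk bound (LT) uses away from the layer bookkeeping. [folklore] -/
theorem biLoc_comm_diagK_legInd_zero {S : Fin (d + 1) → Site (d + 1) → MKer (d + 1) (Fib d)} {C δ : ℝ}
    (hS : LocStencil S C δ) (hδ : 0 ≤ δ) (B : Finset (Site (d + 1))) (ρ : Site (d + 1)) (ξ : ℝ) (κ' : Fin (d + 1))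
    (u' : Site (d + 1)) :
    BiLoc (comp (S κ' u') (diagK (ξ • ∑ u ∈ B, legInd ρ u)) - comp (diagK (ξ • ∑ u ∈ B, legInd ρ u)) (S κ' u')) u' u'
      (|ξ| * C * Real.exp (δ * l1 ρ)) (δ / 2) := by
  have h := biLoc_comm_diagK_legInd hS hδ B ρ ξ κ' u' (R := 0) (fun μ w _ => l1_nonneg _)
  simpa using h

end Summit.QuantumFields.BalabanUV.Beta.GAN24.LayerCommutatorSupport
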